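import Literature.Barriers.ResolutionOfSingularities.SigmaMaxContainsFullEdimCurve
import Literature.AlgebraicGeometry.Hironaka2017.Proofs.S04CharAlgebra.WQ3SigmaMaxCurve
import Literature.AlgebraicGeometry.Hironaka2017.Proofs.S04CharAlgebra.WQ3SigmaMaxOrigin
import Literature.AlgebraicGeometry.Hironaka2017.Proofs.S04CharAlgebra.WQ3SigmaMaxSing
import Literature.AlgebraicGeometry.Hironaka2017.Proofs.S04CharAlgebra.WQ3PAlgStalk
import Literature.AlgebraicGeometry.Hironaka2017.Proofs.S16Proof.WQ3InvSlotTc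
import Literature.AlgebraicGeometry.Hironaka2017.Proofs.S16Proof.WQ3InvSlotClosed
import Literature.AlgebraicGeometry.Hironaka2017.S04CharAlgebra.R007aInv
import HarnessLib

/-!
# Barrier supplement: `SigmaMaxContainsFullEdimCurve` — the COMPANION specimen W2′ ⊂ 𝔸⁴, characteristic 3: the torus stratum
# `T = z-axis ∪ w-axis ∪ γ̄₃ ∋ P₀ = (1,1,1,1)` lies in no regular hypersurface germ at `0` (embedding dimension `4`), and, IN THE KERNEL for
# the algebraic `℘`, `Inv ≡ (4,3,3)` (edge ideal `(x̃̄³)`) at EVERY `K`-point of `T ⊇ Sing(E)(K)` — so `Σ_max(Inv) = Sing(E) = T`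

`Literature/Barriers/ResolutionOfSingularities/SigmaMaxContainsFullEdimCurveW3.lean` — second kernel SUPPLEMENT to the catalogue entry
`SigmaMaxContainsFullEdimCurve.lean` (p490345) after `SigmaMaxContainsFullEdimCurveInv.lean` (p511637, the W-Q witness in `𝔸⁵`,
characteristic `2`); cell res-hironaka, D-0089; drafter res-type-046, the entry's filer. It closes the entry's scope caveat (d) and the
first supplement's caveat (c) «the companion W2′ = `(x³ + G, 3) ⊂ 𝔸⁴`, `char 3`, weights `(41; 9, 12, 13)` (`WQ3Witness`) … is not
treated»: DIMENSION FOUR — the lowest dimension in which resolution of singularities in positive characteristic is open — and ODD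
characteristic.

HONEST FRAMING. H. Hironaka, *Resolution of singularities in positive characteristics*, ms. 2017 [Hironaka2017] is an UNREFEREED
MANUSCRIPT UNDER ADJUDICATION (D-0012); its definitions (`℘`, edge data Def. 4.9, `Inv` Eq. (34), `Σ_max` / Eq. (43)) are typed by
the cell as candidates and only COMPUTED WITH here, on the cell's OWN specimen; nothing printed in the manuscript is asserted, nothing
here is a verdict on any printed sentence, nothing bears on resolution of singularities in characteristic `p`. AI proof, weaker than
expert review.

## Contents
* §1 the parent entry's ∀-statement applied in `𝔸⁴`: weights `e = (41, 9, 12, 13)` — `0` and each `e_i` uniquely representable in `⟨e⟩`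
  (`WQ3Witness.edim_gamma_41/_9/_12/_13`); the set `T(K) = z-axis ∪ w-axis ∪ γ₃(K)` (`TcSet3`) contains `P₀ = (1,1,1,1)` and is stable
  under the torus `λ·(x,y,z,w) = (λ⁴¹x, λ⁹y, λ¹²z, λ¹³w)`; hence (`TcSet3_noSmoothHypersurface`) over an infinite field NO hypersurface
  through `0` smooth at `0` contains `T(K)`.
* §2 value level: `inv433 = (4, 3, 3)`; `invmaxStratum_eq_of_const` — a reading constant on `S` has `Invmax`-stratum `S`.
* §3 `SigmaMaxContainsFullEdimCurveW3` — the headline conjunction (T′) + (Σ) + (V′) + (S′).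
-/

noncomputable section

namespace Literature.Barriers.ResolutionOfSingularities

open MvPolynomial Literature.AlgebraicGeometry.Hironaka2017.S04CharAlgebra
open Literature.AlgebraicGeometry.Hironaka2017.Datum (EdgeInv)

universe u

/-! ## §1 The companion specimen in `𝔸⁴`: weights `(41, 9, 12, 13)`, the set `T = z-axis ∪ w-axis ∪ γ₃` -/

namespace WQ3SigmaMax

open Literature.AlgebraicGeometry.Hironaka2017.WQ3Witness (edim_gamma_41 edim_gamma_9 edim_gamma_12 edim_gamma_13)

/-- The weights `(41, 9, 12, 13)` of the W2′ torus / the exponents of the curve `γ₃`. [folklore] -/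
def wq3Exp : Fin 4 → ℕ := ![41, 9, 12, 13]

/-- `e₀ = 41`. [folklore] -/
@[simp] private theorem wq3Exp_zero : wq3Exp 0 = 41 := rfl
/-- `e₁ = 9`. [folklore] -/
@[simp] private theorem wq3Exp_one : wq3Exp 1 = 9 := rfl
/-- `e₂ = 12`. [folklore] -/
@[simp] private theorem wq3Exp_two : wq3Exp 2 = 12 := rfl
/-- `e₃ = 13`. [folklore] -/
@[simp] private theorem wq3Exp_three : wq3Exp 3 = 13 := rfl

/-- The weight written out. [folklore] -/
private theorem weight_wq3_apply (d : Fin 4 →₀ ℕ) :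
    FullEdimCurve.weight wq3Exp d = 41 * d 0 + 9 * d 1 + 12 * d 2 + 13 * d 3 := by
  simp [FullEdimCurve.weight, Fin.sum_univ_succ]
  ring

/-- Weight `0` only for the zero exponent. [claim: Hironaka2017, status: under-review]
STATUS: kernel fact about the cell's OWN specimen W2′ (prior record WQ3-DIM4, tree `WQ3Witness`), bearing on Eq. (43) p.30 / Rem. 15.4 p.76; nothing of the manuscript is asserted (D-0012/D-0089). -/
theorem weight_wq3_eq_zero_iff (d : Fin 4 →₀ ℕ) : FullEdimCurve.weight wq3Exp d = 0 ↔ d = 0 := by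
  rw [weight_wq3_apply]
  constructor
  · intro h
    ext j; fin_cases j <;> simp <;> omega
  · rintro rfl; simp

/-- `γ₃ = (t⁴¹, t⁹, t¹², t¹³)` has embedding dimension `4` at `0`: each weight `e_i` is attained only by `x_i` (the tree's
`WQ3Witness.edim_gamma_*`). [claim: Hironaka2017, status: under-review]
STATUS: kernel fact about the cell's OWN specimen W2′, bearing on Eq. (43) p.30 / Rem. 15.4 p.76; nothing of the manuscript is asserted (D-0012/D-0089). -/
theorem weight_wq3_eq_exp_iff (d : Fin 4 →₀ ℕ) (i : Fin 4) :
    FullEdimCurve.weight wq3Exp d = wq3Exp i ↔ d = Finsupp.single i 1 := by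
  rw [weight_wq3_apply]
  constructor
  · intro h
    fin_cases i
    · have h' : 41 * d 0 + 9 * d 1 + 12 * d 2 + 13 * d 3 = 41 := h
      by_cases h0 : d 0 = 0
      · exact absurd (by rw [h0] at h'; omega) (edim_gamma_41 (d 1) (d 2) (d 3))
      · ext j; fin_cases j <;> simp <;> omega
    · have h' : 41 * d 0 + 9 * d 1 + 12 * d 2 + 13 * d 3 = 9 := h
      by_cases h0 : d 1 = 0
      · exact absurd (by rw [h0] at h'; omega) (edim_gamma_9 (d 0) (d 2) (d 3))
      · ext j; fin_cases j <;> simp <;> omega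
    · have h' : 41 * d 0 + 9 * d 1 + 12 * d 2 + 13 * d 3 = 12 := h
      by_cases h0 : d 2 = 0
      · exact absurd (by rw [h0] at h'; omega) (edim_gamma_12 (d 0) (d 1) (d 3))
      · ext j; fin_cases j <;> simp <;> omega
    · have h' : 41 * d 0 + 9 * d 1 + 12 * d 2 + 13 * d 3 = 13 := h
      by_cases h0 : d 3 = 0
      · exact absurd (by rw [h0] at h'; omega) (edim_gamma_13 (d 0) (d 1) (d 2))
      · ext j; fin_cases j <;> simp <;> omega
  · rintro rfl
    fin_cases i <;> simp

variable (K : Type u) [Field K]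

/-- `T(K) = z-axis ∪ w-axis ∪ γ₃(K) ⊂ K⁴` (the origin is `γ₃(0)` and lies on both axes). [claim: Hironaka2017, status: under-review]
STATUS: the cell's OWN point set on its OWN specimen (K3.2″ §4 (H)); nothing of the manuscript is asserted (D-0012/D-0089). -/
def TcSet3 : Set (Fin 4 → K) :=
  {p | p = ![0, 0, p 2, 0] ∨ p = ![0, 0, 0, p 3] ∨ ∃ s : K, p = ![s ^ 41, s ^ 9, s ^ 12, s ^ 13]}

/-- `P₀ = (1,1,1,1) = γ₃(1) ∈ T(K)`. [claim: Hironaka2017, status: under-review]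
[cite: Hironaka2017, Eq. (43) p.30 l.8 (unrefereed manuscript under adjudication — kernel fact about the cell's own point set, nothing of the manuscript asserted)] -/
theorem one_mem_TcSet3 : (fun _ => (1 : K)) ∈ TcSet3 K := by
  refine Or.inr (Or.inr ⟨1, ?_⟩)
  funext i
  fin_cases i <;> simp

/-- **`T(K)` is stable under the torus `λ·(x,y,z,w) = (λ⁴¹x, λ⁹y, λ¹²z, λ¹³w)`** (`γ₃(s) ↦ γ₃(λs)`, each axis to itself).
[claim: Hironaka2017, status: under-review]
[cite: Hironaka2017, Eq. (43) p.30 l.8 (unrefereed manuscript under adjudication — kernel fact about the cell's own point set, nothing of the manuscript asserted)] -/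
theorem torus_mem_TcSet3 (c : K) {P : Fin 4 → K} (hP : P ∈ TcSet3 K) : FullEdimCurve.torus K wq3Exp c P ∈ TcSet3 K := by
  rcases hP with h | h | ⟨s, h⟩
  · refine Or.inl ?_
    rw [h]
    funext i
    fin_cases i <;> simp [FullEdimCurve.torus, wq3Exp]
  · refine Or.inr (Or.inl ?_)
    rw [h]
    funext i
    fin_cases i <;> simp [FullEdimCurve.torus, wq3Exp]
  · refine Or.inr (Or.inr ⟨c * s, ?_⟩)
    rw [h]
    funext i
    fin_cases i <;> simp [FullEdimCurve.torus, wq3Exp, mul_pow]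

/-- **The parent entry applied to `T(K)`**: over an infinite field, NO hypersurface `F = 0` through the origin that is smooth there
contains `T(K)` — it contains the curve `γ₃` of embedding dimension `4` at `0` (`FullEdimCurve.not_isSmoothAtOrigin_of_torusStable` in
`𝔸⁴`). [cite: Kollar2007, Aside 3.57] -/
theorem TcSet3_noSmoothHypersurface [Infinite K] :
    ¬ ∃ F : MvPolynomial (Fin 4) K, IsSmoothAtOrigin F ∧ ∀ P ∈ TcSet3 K, eval P F = 0 := by
  rintro ⟨F, hsm, hF⟩
  exact FullEdimCurve.not_isSmoothAtOrigin_of_torusStable wq3Exp weight_wq3_eq_zero_iff weight_wq3_eq_exp_iff (TcSet3 K)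
    (fun c _ P hP => torus_mem_TcSet3 K c hP) (one_mem_TcSet3 K) F hF hsm

end WQ3SigmaMax

/-! ## §2 The value `(4, 3, 3)` and constant readings -/

namespace SigmaMaxInv3

/-- The Eq. (34) value `(n, n − r, q₁) = (4, 3, 3)`: one edge generator of exponent `q₁ = 3` in ambient dimension `4`
(row 007's packaging map `invOfExponents`; K3.2″ `key_inv_W3`). [claim: Hironaka2017, status: under-review]
STATUS: a term of the tree's value type; nothing of the manuscript is asserted (D-0012/D-0089). -/
def inv433 : EdgeInv 4 := invOfExponents 4 [3] (by decide) (by decide)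

/-- `inv433.q = [3]`. [claim: Hironaka2017, status: under-review]
[cite: Hironaka2017, Eq. (34) p.24 l.29–31 (unrefereed manuscript under adjudication — kernel fact about the tree's value type, nothing of the manuscript asserted)] -/
theorem inv433_q : inv433.q = [3] := rfl

/-- **The `Invmax`-stratum of a CONSTANT reading is everything**: for ANY set of points `S` and ANY `Inv`-reading `f` with `f ≡ v` on `S`,
row 007's `invmaxStratum S f` (the set of Eq. (43) p.30 «`{ξ ∈ Sing(Ê)_cl | Inv_ξ(Ê) = Invmax(Ê)}`») equals `S`.
[claim: Hironaka2017, status: under-review]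
[cite: Hironaka2017, Eq. (43) p.30 l.8 · Eq. (34) p.24 l.29–31 (unrefereed manuscript under adjudication — kernel fact about row 007's set, nothing of the manuscript asserted)] -/
theorem invmaxStratum_eq_of_const {n : ℕ} {P : Type u} (S : Set P) (f : P → EdgeInv n) (v : EdgeInv n)
    (h : ∀ ξ ∈ S, f ξ = v) : invmaxStratum S f = S := by
  ext ξ
  constructor
  · rintro ⟨hξS, -⟩
    exact hξS
  · intro hξ
    refine ⟨hξ, fun η hη => ?_⟩
    show (f η).key ≤ (f ξ).key
    rw [h η hη, h ξ hξ]

end SigmaMaxInv3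

/-! ## §3 The headline -/

open WQ3SigmaMax SigmaMaxInv3 WQ3Tc TriplePoint in
/-- **`SigmaMaxContainsFullEdimCurveW3` — KERNEL SUPPLEMENT to the barrier entry `SigmaMaxContainsFullEdimCurve` (p490345) for its
COMPANION specimen W2′: `E = (f, 3)`, `f = x³ + G` on `𝔸⁴`, characteristic `3` (tree `WQ3Witness`), at the level of the ALGEBRAIC
characteristic algebra.**

The entry's scope caveat (d) (and the first supplement's (c)) left W2′ untreated; the kill test K3.2″ (cell res-hironaka) found by HAND + kit
that `Inv ≡ (4,3,3)` on all of `Sing(Ê)(W2′) = z-axis ∪ w-axis ∪ γ̄₃ ∋ P₀ = (1,1,1,1)`, `γ₃(s) = (s⁴¹, s⁹, s¹², s¹³)`. THIS THEOREM is that statement in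
the kernel for OUR typed ALGEBRAIC `℘` (`S04CharAlgebra.pAlgebraicRing`, the manuscript's algebraic definition p.17 l.8–11 typed by row 003;
its agreement with the geometric `℘` is the manuscript's import from [23], Th. 4.4 / U17_4, and is NOT used or asserted here), for EVERY field
`K` of characteristic `3` and all `K`-points (the `z`-axis through the cubes `(0,0,c³,0)` — all of its `K`-points when `K` is perfect). With
`f_p` the witness re-centred at the `K`-point `p` (and tilted where `in_p f` is the cube of a linear form other than `x̄`) and `℘alg(E_p, a)` the
degree-`a` piece of the algebraic `℘` of `((f_p), 3)`:
* (T′) ON `T` — at the origin (`WQ3Tc.origin_hupLift`: quasi-homogeneous twisted arc, `W = 55`), at every `(0,0,0,c)`, `c ≠ 0`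
  (`wAxis_hupLift`, `d = 4`, `K_d = c⁶ȳz̄³`), at every `(0,0,c³,0)`, `c ≠ 0` (`zAxis_hupLift`, tilt `x̃ = x + c⁷w + c⁸y`, `d = 4`), and at every
  `γ₃(s)`, `s ≠ 0` (`curve_hupLift`, `d = 4` after the tilt `x̃_s = x + s³²y + s²⁹z + s²⁸w`, transported by the linear automorphism `β_s`):
  (i) `℘alg(E_p, a) ⊆ 𝔪_p^a`; (ii) for `a ≥ 1` the degree-`a` initial form of EVERY element of `℘alg(E_p, a)` is divisible by `x̃̄³`; (ii′)
  `℘alg(E_p, 1) ⊆ 𝔪_p²`, `℘alg(E_p, 2) ⊆ 𝔪_p³` — NO element of order `1` or `2`; (iii) `f_p ∈ ℘alg(E_p, 3)` with `f_p − x̃³ ∈ 𝔪_p⁴`: the form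
  `x̃̄³` is attained. Hence (Def. 4.9 p.20 l.31–35; the cell's kernel pattern `hup + lift identity ⇒ exists_isEdgeData_pure`): edge ideal
  `(x̃̄³)`, ONE generator, `r = 1`, `q₁ = 3`, Eq. (34) value `(4, 3, 3)` at every `K`-point of `T`.
* (Σ) `Sing(E)(K) ⊆ T(K)` (`WQ3Tc.axes_or_curve_of_sing`): a `K`-point at which `f`, `∂_y f`, `∂_y∂_y f`, `∂_z∂_z f` vanish (a fortiori every
  `K`-point of `Sing(E) = V(f, D^{(≤2)} f)`) lies on the `z`-axis, the `w`-axis or IS `γ₃(s)` with `s = y³/w² ∈ K` (no perfectness needed) —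
  there is NO «off-`T`» part of `Sing(E)` (contrast: the W-Q witness in `𝔸⁵`, where `Inv` drops off `T_c`). INDEPENDENTLY and first
  (RESCUE bed hand 37, res-D-pv-024, p519025) the tree's `S15ARSchemes.WQ3OrderThreeLocus.cases_of_order_three` classifies the same
  `k`-points as the axes or `(y, z) = (a³, a⁴)`, `w³ = a¹³`, `x³ = a⁴¹`, and its `axisZ_mem` / `axisW_mem` / `gammaPoint_mem` give the
  converse (all `21` evaluations vanish on `T`) — cited, not re-derived, here.
* (V′) VALUE LEVEL (row 007): a reading constant on `S` has `invmaxStratum S Inv = S` (`invmaxStratum_eq_of_const`); so for ANY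
  `Inv`-reading with value `(4,3,3)` (`inv433`) on `S = Sing(E)(K)`, `Σ_max(Inv)(K) = Sing(E)(K) = T(K) ∋ P₀`.
* (S′) STRUCTURAL: `T(K)` contains `P₀ = (1,1,1,1)` and is stable under the torus of weights `(41, 9, 12, 13)`; `0` and each weight are uniquely
  representable in `⟨41, 9, 12, 13⟩` (`WQ3Witness.edim_gamma_*`); so the PARENT entry's ∀-statement applies in `𝔸⁴`: over an infinite field of
  characteristic `3` no hypersurface through `0` smooth at `0` contains `T(K)` — `Σ̄_max` contains `γ̄₃` of embedding dimension `4` and is no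
  regular germ, in DIMENSION FOUR.
NOT covered here (as in the first supplement): the passage algebraic `℘` ↔ geometric `℘` ([23], U17_4) and to stalks (locality of edge data),
closed points beyond `K`-points, the `z`-axis points `(0,0,c,0)` with `c ∉ K³` over a non-perfect `K`, anything about later blow-ups. Nothing
here is a claim about resolution of singularities in characteristic `p`, nor a verdict on any printed sentence (D-0012/D-0089).
[claim: Hironaka2017, status: under-review]
[cite: Hironaka2017, Rem. 4.7 / Def. 4.9 p.20 l.13–35 · Def. 4.11 p.21 · Eq. (34) p.24 l.29–31 · Eq. (43) p.30 l.8 · §4 p.17 l.8–11 (unrefereed manuscript under adjudication — kernel computation of OUR typed algebraic ℘ at the cell's companion specimen, nothing of the manuscript asserted)]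

BARRIER (D-0021) — SECOND ADDENDUM to `SigmaMaxContainsFullEdimCurve` (same entry; this file closes its scope caveat (d) / the first addendum's (c)):
- technique_class: canonical-strata regular-cut-as-focus top-locus-as-centre intrinsic-stratification sigma-max embedding-dimension torus-orbit maximal-contact-containment edge-data characteristic-algebra positive-characteristic dimension-four
- blocks: as the parent entry, now witnessed in DIMENSION FOUR and ODD characteristic: on W2′ `= (x³ + G, 3) ⊂ 𝔸⁴`, `char 3`, the manuscript-style edge datum (Def. 4.9 / Eq. (34), computed for the typed ALGEBRAIC `℘`) is the pure cube `(x̃̄³)`, value `(4,3,3)`, at EVERY `K`-point of `T = z-axis ∪ w-axis ∪ γ̄₃` (cubes on the `z`-axis), and `Sing(E)(K) ⊆ T(K)`; so any `Inv`-reading with that value on `Sing(E)` has `Σ_max = Sing(E) = T ∋ P₀`, and the parent's ∀-statement applies to `Σ̄_max` itself: it contains `γ̄₃` of embedding dimension `4` at `0`, lies in no regular hypersurface germ there, and has three components through `0` [claim: Hironaka2017, status: under-review] (the definitions are the manuscript's, typed by the cell; the computation is OURS and kernel-checked here).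
- because: at each point of `T ∖ {0}` the re-centred (and, on the `z`-axis and on `γ₃`, tilted) `f` is a TRIPLE POINT `x̃³ + Q(u)` with `ord Q = 4`, `Q₄ ≠ 0` (`c⁶ȳz̄³`, `7c¹⁸Z̄w̄³ + 8c²¹ȳ³Z̄`, `𝔲₁²𝔲₂²`): the cube-root arc `x̃ ↦ t⁸ r(t²)`, `u ↦ δt⁶`, `r³ = −Σ Q_{4+k}(δ)t^{6k}` (Frobenius) lies on the hypersurface, the Hasse–Schmidt derivatives of `x̃³ + Q` of orders `1, 2` are those of `Q` (`C(3,1) = C(3,2) = 0`), of arc weights `18`, `12`, so the arc weight bound for the integral closure (`Lib/PAlgArcWeight`, weight hypothesis `Lib/PAlgArcHasse`, `b = 3`) gives `t^{9a} ∣ Ψ(g)` on `℘alg(E,a)`, and the coefficients of weights `6a`, `6a+2`, `6a+4` are the `x̃̄`-free, `x̃̄`-linear, `x̃̄²`-parts of `in_a(g)` at the generic point (`TriplePoint.triplePoint_hupLift`); at the ORIGIN (`ord G = 10`, where that arc collides) the twisted weighted arc `x ↦ ρt⁴¹`, `(y,z,w) ↦ (δ₁t⁹, δ₂t¹², δ₃t¹³)`,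 `ρ³ = −G(δ)` has weight `55` (`∂_z G` of weight `111`), every weighted component of `g ∈ ℘alg(E,a)` of weight `< 55a` vanishes at `(ρ,δ)`, hence is a multiple of `x³ + G` (the minimal polynomial of `ρ` over `Frac K[y,z,w]`: `G` is no cube as `∂_y G ≠ 0`), so `g = (x³+G)q + g′`, `g′ ∈ 𝔪^{a+1}`, `q ∈ 𝔪^{a−3}`, `in_a(g) = x̄³ in_{a−3}(q)` (`QhTriple.qhTriple_hupLift`); the torus curve is reached from `P₀` by the LINEAR automorphism `β_s` (`WQ3Tc.β_fγ`); `Sing(E)(K) ⊆ T(K)` because `∂_y∂_y f = 2y³(w³ − y³z)²` and `∂_z∂_z f = 2y³(z³ − y⁴)²` in characteristic `3` (`WQ3Tc.axes_or_curve_of_sing`).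
- evasions_known: as the parent entry ((i) refine by embedding dimension; (ii) non-faithful stratifiers / weak maximal contact / projections; (iii) avoid maximal-contact containment; (iv) blow up first); nothing new.
- scope_caveats: (a) PROVED here: parent scope (d) — the W2′ companion — in the form (T′) + (Σ) + (V′) + (S′) above, for the ALGEBRAIC `℘` of the manuscript's p.17 definition as typed by row 003, every field `K` of characteristic `3`, all `K`-points of `T` (the `z`-axis through cubes `c³`); (b) NOT covered: algebraic `℘` ↔ geometric `℘` ([23], U17_4), stalk-level edge data (row 005), non-`K`-rational closed points, `z`-axis points with non-cube coordinate over imperfect `K`; the reading «pure `(x̃̄³)` ↦ `(4,3,3)`» is the cell's pattern `InvSlotSingAlign.exists_isEdgeData_pure` / Def. 4.11 and is stated, not re-derived, here; (c) nothing here bears on the EXISTENCE of resolutions in characteristic `p`.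
- status: established (kernel-checked: `T ⊇ Sing(E)(K)`, all `K`-points of `T`, every field of characteristic `3`, algebraic `℘`; parent ∀-statement in `𝔸⁴`; the converse `T ⊆ Sing(E)(k)` is the tree's `WQ3OrderThreeLocus`, p519025) -/
theorem SigmaMaxContainsFullEdimCurveW3 :
    (∀ (K : Type u) [Field K] [CharP K 3],
      -- (T′) on `T`: origin (tree coordinates)
      ((∀ a : ℕ, PQ K 3 (G3 K) a ≤ 𝔪 K 3 ^ a) ∧
        (∀ a : ℕ, 1 ≤ a → ∀ g ∈ PQ K 3 (G3 K) a, (X 0 : O K 3) ^ 3 ∣ homogeneousComponent a g) ∧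
        PQ K 3 (G3 K) 1 ≤ 𝔪 K 3 ^ 2 ∧ PQ K 3 (G3 K) 2 ≤ 𝔪 K 3 ^ 3 ∧
        fQ K 3 (G3 K) ∈ PQ K 3 (G3 K) 3 ∧ fQ K 3 (G3 K) - X 0 ^ 3 ∈ 𝔪 K 3 ^ 4) ∧
      -- (T′) punctured `w`-axis `(0,0,0,c)`
      (∀ c : K, c ≠ 0 →
        (∀ a : ℕ, PQ K 3 (Qw K c) a ≤ 𝔪 K 3 ^ a) ∧
        (∀ a : ℕ, 1 ≤ a → ∀ g ∈ PQ K 3 (Qw K c) a, (X 0 : O K 3) ^ 3 ∣ homogeneousComponent a g) ∧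
        PQ K 3 (Qw K c) 1 ≤ 𝔪 K 3 ^ 2 ∧ PQ K 3 (Qw K c) 2 ≤ 𝔪 K 3 ^ 3 ∧
        fQ K 3 (Qw K c) ∈ PQ K 3 (Qw K c) 3 ∧ fQ K 3 (Qw K c) - X 0 ^ 3 ∈ 𝔪 K 3 ^ 4) ∧
      -- (T′) punctured `z`-axis `(0,0,c³,0)` (tilted coordinates)
      (∀ c : K, c ≠ 0 →
        (∀ a : ℕ, PQ K 3 (Qz K c) a ≤ 𝔪 K 3 ^ a) ∧
        (∀ a : ℕ, 1 ≤ a → ∀ g ∈ PQ K 3 (Qz K c) a, (X 0 : O K 3) ^ 3 ∣ homogeneousComponent a g) ∧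
        PQ K 3 (Qz K c) 1 ≤ 𝔪 K 3 ^ 2 ∧ PQ K 3 (Qz K c) 2 ≤ 𝔪 K 3 ^ 3 ∧
        fQ K 3 (Qz K c) ∈ PQ K 3 (Qz K c) 3 ∧ fQ K 3 (Qz K c) - X 0 ^ 3 ∈ 𝔪 K 3 ^ 4) ∧
      -- (T′) punctured torus curve `γ₃(s)` (plain translated coordinates)
      (∀ s : K, s ≠ 0 →
        (∀ a : ℕ, Pγ K s a ≤ 𝔪 K 3 ^ a) ∧
        (∀ a : ℕ, 1 ≤ a → ∀ g ∈ Pγ K s a, xTilde K s ^ 3 ∣ homogeneousComponent a g) ∧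
        Pγ K s 1 ≤ 𝔪 K 3 ^ 2 ∧ Pγ K s 2 ≤ 𝔪 K 3 ^ 3 ∧
        fγ K s ∈ Pγ K s 3 ∧ fγ K s - xTilde K s ^ 3 ∈ 𝔪 K 3 ^ 4) ∧
      -- (Σ) `Sing(E)(K) ⊆ T(K)`
      (∀ p : Fin 4 → K, eval p (Literature.AlgebraicGeometry.Hironaka2017.WQ3Witness.f (R := K)) = 0 →
        eval p (pderiv 1 (Literature.AlgebraicGeometry.Hironaka2017.WQ3Witness.f (R := K))) = 0 →
        eval p (pderiv 1 (pderiv 1 (Literature.AlgebraicGeometry.Hironaka2017.WQ3Witness.f (R := K)))) = 0 →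
        eval p (pderiv 2 (pderiv 2 (Literature.AlgebraicGeometry.Hironaka2017.WQ3Witness.f (R := K)))) = 0 →
        p ∈ TcSet3 K)) ∧
    -- (V′) value level
    (∀ (P : Type u) (S : Set P) (f : P → EdgeInv 4), (∀ ξ ∈ S, f ξ = SigmaMaxInv3.inv433) → invmaxStratum S f = S) ∧
    -- (S′) structural: `T(K)` is torus-stable through `P₀`, so the parent entry applies to it, in `𝔸⁴`
    (∀ (K : Type u) [Field K] [Infinite K],
      (fun _ => (1 : K)) ∈ TcSet3 K ∧
      (∀ c : K, c ≠ 0 → ∀ P ∈ TcSet3 K, FullEdimCurve.torus K wq3Exp c P ∈ TcSet3 K) ∧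
      ¬ ∃ F : MvPolynomial (Fin 4) K, IsSmoothAtOrigin F ∧ ∀ P ∈ TcSet3 K, eval P F = 0) := by
  refine ⟨fun K _ _ => ⟨origin_hupLift K, fun c hc => wAxis_hupLift K hc, fun c hc => zAxis_hupLift K hc,
    fun s hs => curve_hupLift K hs, fun p h0 h1 h11 h22 => axes_or_curve_of_sing K p h0 h1 h11 h22⟩,
    fun P S f hf => invmaxStratum_eq_of_const S f _ hf,
    fun K _ _ => ⟨one_mem_TcSet3 K, fun c _ P hP => torus_mem_TcSet3 K c hP, TcSet3_noSmoothHypersurface K⟩⟩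

/-! ## §4 Scope caveat (b) at stalk level: the GEOMETRIC `℘` at every `K`-point of `T` (`K` perfect) -/

open _root_.AlgebraicGeometry WQ3SigmaMax WQ3Tc WQ3Stalk TriplePoint Literature.AlgebraicGeometry.Hironaka2017.SpecOrders
  Literature.AlgebraicGeometry.Hironaka2017.S02Preliminaries Literature.AlgebraicGeometry.Resolution IsLocalRing in
/-- **`SigmaMaxContainsFullEdimCurveW3_stalk` — scope caveat (b) «algebraic ↔ geometric ℘» of the headline above, DISCHARGED AT STALK
LEVEL for perfect `K` (the rescue bed's currency, `Lib/AffinePAlgBridge` res-type-076 / `BedWQPAlgStalk` p519700; file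
`Proofs/S04CharAlgebra/WQ3PAlgStalk.lean`).** For `K` PERFECT of characteristic `3` and, at each of the five point classes of
`T = z-axis ∪ w-axis ∪ γ̄₃`, for EVERY ideal exponent `E` on `𝔸⁴_K` with `E.b = 3` whose ideal is generated by the specimen re-centred
(and, on the `z`-axis through cubes and on `γ₃`, tilted) at that point — `f` (origin), `translW_c f` (`(0,0,0,c)`, `c ≠ 0`), `σZ_c f`
(`(0,0,c³,0)`, `c ≠ 0`), `θ₀ f` (`P₀`), `fγ s` (`γ₃(s)`, `s ≠ 0`) —, the GEOMETRIC `℘ = pAlg` (row 003, p.17 l.2–3) at the stalk of the point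
satisfies: `℘(E,a)_p ⊆ 𝔪_p^a` for all `a`; `℘(E,1)_p ⊆ 𝔪_p²` and `℘(E,2)_p ⊆ 𝔪_p³` (NO generator of degree `1` or `2`: `t = 0`);
`℘(E,3)_p ⊆ (x̃³)·𝒪_p + 𝔪_p⁴` and `f_p ∈ ℘(E,3)_p`, `f_p − x̃³ ∈ 𝔪_p⁴` (degree-`3` slot exactly `K·x̃̄³`; `x̃ = x` except on `γ₃`, where
`x̃ = x̃_s = x + s³²y + s²⁹z + s²⁸w`). Literature input: Hironaka 2005 (F-20d, F-21e), tree theorems, through U17_4 — no binder. What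
remains NOT covered: non-`K`-rational closed points, imperfect `K`, later blow-ups. [claim: Hironaka2017, status: under-review]
[cite: Hironaka2017, §4 p.17 l.2–17 · Rem. 4.7 / Def. 4.9 p.20 l.13–35 · Eq. (34) p.24 l.29–31 (unrefereed manuscript under adjudication — kernel computation of OUR typed ℘ (geometric, via U17_4 over tree theorems) at the cell's companion specimen, nothing of the manuscript asserted)] -/
theorem SigmaMaxContainsFullEdimCurveW3_stalk (K : Type) [Field K] [CharP K 3] [PerfectField K]
    (E : IdealExponent (Zs (O K 3))) (hb : E.b = 3) :
    -- origin (tree coordinates)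
    (E.J.ideal ⟨⊤, isAffineOpen_top _⟩ =
        (Ideal.span {(Literature.AlgebraicGeometry.Hironaka2017.WQ3Witness.f : O K 3)}).map (toΓ (O K 3)) →
      (∀ a, stalkIdeal (pAlg E a) (CoordChart.origin K (Fin 4)) ≤ maximalIdeal (St (O K 3) (CoordChart.origin K (Fin 4))) ^ a) ∧
      stalkIdeal (pAlg E 1) (CoordChart.origin K (Fin 4)) ≤ maximalIdeal (St (O K 3) (CoordChart.origin K (Fin 4))) ^ 2 ∧
      stalkIdeal (pAlg E 2) (CoordChart.origin K (Fin 4)) ≤ maximalIdeal (St (O K 3) (CoordChart.origin K (Fin 4))) ^ 3 ∧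
      stalkIdeal (pAlg E 3) (CoordChart.origin K (Fin 4)) ≤
        Ideal.span {algebraMap (O K 3) (St (O K 3) (CoordChart.origin K (Fin 4))) (X 0 ^ 3)} ⊔
          maximalIdeal (St (O K 3) (CoordChart.origin K (Fin 4))) ^ 4 ∧
      (algebraMap (O K 3) (St (O K 3) (CoordChart.origin K (Fin 4))) Literature.AlgebraicGeometry.Hironaka2017.WQ3Witness.f ∈
          stalkIdeal (pAlg E 3) (CoordChart.origin K (Fin 4)) ∧
        algebraMap (O K 3) (St (O K 3) (CoordChart.origin K (Fin 4))) Literature.AlgebraicGeometry.Hironaka2017.WQ3Witness.f -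
            algebraMap (O K 3) (St (O K 3) (CoordChart.origin K (Fin 4))) (X 0 ^ 3) ∈
          maximalIdeal (St (O K 3) (CoordChart.origin K (Fin 4))) ^ 4)) ∧
    -- punctured `w`-axis
    (∀ c : K, c ≠ 0 → E.J.ideal ⟨⊤, isAffineOpen_top _⟩ =
        (Ideal.span {translW K c (Literature.AlgebraicGeometry.Hironaka2017.WQ3Witness.f (R := K))}).map (toΓ (O K 3)) →
      stalkIdeal (pAlg E 1) (CoordChart.origin K (Fin 4)) ≤ maximalIdeal (St (O K 3) (CoordChart.origin K (Fin 4))) ^ 2 ∧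
      stalkIdeal (pAlg E 2) (CoordChart.origin K (Fin 4)) ≤ maximalIdeal (St (O K 3) (CoordChart.origin K (Fin 4))) ^ 3 ∧
      stalkIdeal (pAlg E 3) (CoordChart.origin K (Fin 4)) ≤
        Ideal.span {algebraMap (O K 3) (St (O K 3) (CoordChart.origin K (Fin 4))) (X 0 ^ 3)} ⊔
          maximalIdeal (St (O K 3) (CoordChart.origin K (Fin 4))) ^ 4) ∧
    -- punctured `z`-axis through cubes (tilted coordinates)
    (∀ c : K, c ≠ 0 → E.J.ideal ⟨⊤, isAffineOpen_top _⟩ =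
        (Ideal.span {σZ K c (Literature.AlgebraicGeometry.Hironaka2017.WQ3Witness.f (R := K))}).map (toΓ (O K 3)) →
      stalkIdeal (pAlg E 1) (CoordChart.origin K (Fin 4)) ≤ maximalIdeal (St (O K 3) (CoordChart.origin K (Fin 4))) ^ 2 ∧
      stalkIdeal (pAlg E 2) (CoordChart.origin K (Fin 4)) ≤ maximalIdeal (St (O K 3) (CoordChart.origin K (Fin 4))) ^ 3 ∧
      stalkIdeal (pAlg E 3) (CoordChart.origin K (Fin 4)) ≤
        Ideal.span {algebraMap (O K 3) (St (O K 3) (CoordChart.origin K (Fin 4))) (X 0 ^ 3)} ⊔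
          maximalIdeal (St (O K 3) (CoordChart.origin K (Fin 4))) ^ 4) ∧
    -- `P₀` (adapted coordinates)
    (E.J.ideal ⟨⊤, isAffineOpen_top _⟩ =
        (Ideal.span {θP0 K (Literature.AlgebraicGeometry.Hironaka2017.WQ3Witness.f (R := K))}).map (toΓ (O K 3)) →
      stalkIdeal (pAlg E 1) (CoordChart.origin K (Fin 4)) ≤ maximalIdeal (St (O K 3) (CoordChart.origin K (Fin 4))) ^ 2 ∧
      stalkIdeal (pAlg E 2) (CoordChart.origin K (Fin 4)) ≤ maximalIdeal (St (O K 3) (CoordChart.origin K (Fin 4))) ^ 3 ∧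
      stalkIdeal (pAlg E 3) (CoordChart.origin K (Fin 4)) ≤
        Ideal.span {algebraMap (O K 3) (St (O K 3) (CoordChart.origin K (Fin 4))) (X 0 ^ 3)} ⊔
          maximalIdeal (St (O K 3) (CoordChart.origin K (Fin 4))) ^ 4) ∧
    -- punctured torus curve (plain translated coordinates, cube `x̃_s³`)
    (∀ s : K, s ≠ 0 → E.J.ideal ⟨⊤, isAffineOpen_top _⟩ = (Ideal.span {fγ K s}).map (toΓ (O K 3)) →
      stalkIdeal (pAlg E 1) (CoordChart.origin K (Fin 4)) ≤ maximalIdeal (St (O K 3) (CoordChart.origin K (Fin 4))) ^ 2 ∧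
      stalkIdeal (pAlg E 2) (CoordChart.origin K (Fin 4)) ≤ maximalIdeal (St (O K 3) (CoordChart.origin K (Fin 4))) ^ 3 ∧
      stalkIdeal (pAlg E 3) (CoordChart.origin K (Fin 4)) ≤
        Ideal.span {algebraMap (O K 3) (St (O K 3) (CoordChart.origin K (Fin 4))) (xTilde K s ^ 3)} ⊔
          maximalIdeal (St (O K 3) (CoordChart.origin K (Fin 4))) ^ 4) :=
  ⟨fun hJ => originStalk K E hb hJ,
    fun _ hc hJ => ⟨(wAxisStalk K E hb hc hJ).2.1, (wAxisStalk K E hb hc hJ).2.2.1, (wAxisStalk K E hb hc hJ).2.2.2.1⟩,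
    fun _ hc hJ => ⟨(zAxisStalk K E hb hc hJ).2.1, (zAxisStalk K E hb hc hJ).2.2.1, (zAxisStalk K E hb hc hJ).2.2.2.1⟩,
    fun hJ => ⟨(P0Stalk K E hb hJ).2.1, (P0Stalk K E hb hJ).2.2.1, (P0Stalk K E hb hJ).2.2.2.1⟩,
    fun _ hs hJ => ⟨(curveStalk K E hb hs hJ).2.1, (curveStalk K E hb hs hJ).2.2.1, (curveStalk K E hb hs hJ).2.2.2.1⟩⟩

/-! ## §5 Scope caveat (b) «stalk-level edge data (row 005)» and headline (V′) for the TYPED SLOT OF RECORD, at the points of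
`E_W2′` themselves (`K` perfect): `Σ_max(slot)(K) = Sing(E_W2′)(K) = T(K) ∋ P₀` -/

open _root_.AlgebraicGeometry WQ3SigmaMax WQ3Geom Literature.AlgebraicGeometry.Hironaka2017.SpecOrders
  Literature.AlgebraicGeometry.Hironaka2017.S02Preliminaries Literature.AlgebraicGeometry.Resolution
  Literature.AlgebraicGeometry.Hironaka2017 in
/-- **`SigmaMaxContainsFullEdimCurveW3_slot` — headline (V′) «for ANY `Inv`-reading constant `(4,3,3)` on `T`» and scope caveat (b) «stalk-level
edge data (row 005)» DISCHARGED FOR THE TYPED SLOT OF RECORD (row 019 `S16Proof.invOfChoiceBot`, EVERY edge choice `c`, GEOMETRIC `℘`)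
AT THE POINTS OF `E_W2′ = ((f)·𝒪_{𝔸⁴}, 3)` THEMSELVES** (file `Proofs/S16Proof/WQ3InvSlotTc.lean`, on the pure-power / linear-re-centring
one-calls `Proofs/S16Proof/InvSlotAffineTranslationPurePower.lean` — the `b = p^e` edition of res-D-pv-057's `InvSlotAffineTranslation` /
`WQInvSlotTc` (the W-Q witness, `char 2`) —, res-type-084's `S16Proof.invOfChoiceBot_q_eq_purePower` and res-type-076's binder-free U17_4
bridge). For `K` PERFECT of characteristic `3`:
(1) at EVERY `K`-point `v ∈ T(K) = z-axis ∪ w-axis ∪ γ₃(K)` (`TcSet3`; every `z`-axis point is `(0,0,d³,0)` as `K` is perfect) and for every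
edge choice, `invOfChoiceBot c E_W2′ (pt v) = inv433 = (4, 3, 3)` (`r = 1`, `q = [3]`, `t = 0`) — no re-centred carrier, no reading
hypothesis; (2) the `K`-rational closed points of `Sing(E_W2′)` are EXACTLY the `pt v`, `v ∈ T(K)` (order-`3` test through the
Hasse–Schmidt derivatives + `WQ3Tc.axes_or_curve_of_sing`; converse from the packages); (3) hence the slot of record is CONSTANT on the
set `ratSing` of `K`-rational singular closed points and its `Invmax`-stratum (row 007 `invmaxStratum`, Eq. (43) p.30) over that set is the
whole set `= pt″T(K)`, which contains `pt P₀`, `P₀ = (1,1,1,1) = γ₃(1)`; with §1 (`TcSet3_noSmoothHypersurface`): `T(K)` lies in no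
hypersurface smooth at `0` (`K` infinite) — the parent entry's ∀-statement for `Σ_max` OF THE TYPED `Inv`, dimension four, odd characteristic.
Still NOT covered: non-`K`-rational closed points of `Sing(E_W2′)`; imperfect `K`; later blow-ups. Cross-reference: the W-Q witness (`char 2`,
`𝔸⁵`) has the same slot statement in res-D-pv-057's `WQGeom.invOfChoiceBot_eq_inv542_of_mem_TcSet` (p526040). [claim: Hironaka2017, status: under-review]
[cite: Hironaka2017, Eq. (34) p.24 l.29–31 · Def. 4.9 p.20 l.31–35 · Eq. (43) p.30 l.8 · §4 p.17 l.2–17 (unrefereed manuscript under adjudication — kernel computation of OUR typed slot (geometric ℘, via U17_4 over tree theorems) at the cell's companion specimen, nothing of the manuscript asserted)] -/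
theorem SigmaMaxContainsFullEdimCurveW3_slot (K : Type) [Field K] [CharP K 3] [PerfectField K] :
    -- (1) the slot of record at every `K`-point of `T`
    (∀ v ∈ TcSet3 K, ∀ c : S16Proof.EdgeChoice.{0} 3 4,
      S16Proof.invOfChoiceBot c (EW3 K) (AffineTransl.pt K v) = SigmaMaxInv3.inv433) ∧
    -- (2) the `K`-rational closed points of `Sing(E_W2′)` are the points of `T(K)`
    (∀ v : Fin 4 → K, AffineTransl.pt K v ∈ (EW3 K).sing ↔ v ∈ TcSet3 K) ∧
    (ratSing K = AffineTransl.pt K '' TcSet3 K) ∧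
    -- (3) `Σ_max` of the slot over the `K`-rational singular points is all of them, and contains `pt P₀`
    (∀ c : S16Proof.EdgeChoice.{0} 3 4, invmaxStratum (ratSing K) (S16Proof.invOfChoiceBot c (EW3 K)) = ratSing K) ∧
    AffineTransl.pt K (fun _ : Fin 4 => (1 : K)) ∈ ratSing K := by
  have hT : ∀ v : Fin 4 → K, v ∈ TcSet3 K ↔ (v = ![0, 0, v 2, 0] ∨ v = ![0, 0, 0, v 3] ∨ ∃ s : K, v = γpt K s) := fun v => Iff.rfl
  refine ⟨fun v hv c => invOfChoiceBot_eq_of_cases K ((hT v).mp hv) c, fun v => ?_, ?_, invmaxStratum_ratSing_eq K, pt_P0_mem_ratSing K⟩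
  · rw [hT]; exact pt_mem_sing_iff_cases K v
  · ext x
    rw [mem_ratSing_iff]
    constructor
    · rintro ⟨v, rfl, hv⟩
      exact ⟨v, (hT v).mpr hv, rfl⟩
    · rintro ⟨v, hv, rfl⟩
      exact ⟨v, rfl, (hT v).mp hv⟩

/-! ## §6 `K` ALGEBRAICALLY CLOSED of characteristic `3`: Eq. (43)'s `Σ_max` over ALL closed singular points, no rationality proviso -/

open _root_.AlgebraicGeometry WQ3SigmaMax WQ3Geom Literature.AlgebraicGeometry.Hironaka2017.SpecOrders
  Literature.AlgebraicGeometry.Hironaka2017.S02Preliminaries Literature.AlgebraicGeometry.Resolution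
  Literature.AlgebraicGeometry.Hironaka2017 in
/-- **`SigmaMaxContainsFullEdimCurveW3_slot_algClosed` — the slot edition (§5) with the «`K`-rational points only» proviso REMOVED for `K`
ALGEBRAICALLY CLOSED of characteristic `3`** (Nullstellensatz: every closed point of `𝔸⁴_K` is a `K`-point, `AffineTransl.exists_eq_pt_of_mem_closedPoints`;
file `Proofs/S16Proof/WQ3InvSlotClosed.lean`). With `Sing(E_W2′)_cl := Sing(E_W2′) ∩ closedPoints` (`WQ3Geom.singClosed`) — EXACTLY the set of
p.30 l.4–5 / Eq. (43) l.8 for `Ê = E_W2′` — and the typed slot of record (row 019 `invOfChoiceBot`, every edge choice `c`, geometric `℘`):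
(1) `Sing(E_W2′)_cl = pt″T(K)`, `T = z-axis ∪ w-axis ∪ γ₃` (`TcSet3`); (2) `Inv ≡ (4,3,3)` on `Sing(E_W2′)_cl`; (3) `Invmax(E_W2′) = (4,3,3)` IS ATTAINED
(row 007 `IsInvmax`); (4) `Σ_max` (row 007 `invmaxStratum` over `Sing(E_W2′)_cl`) is ALL of `Sing(E_W2′)_cl = pt″T(K)` ∋ `pt P₀`; with §1: `T(K)` is
torus-stable through `P₀` and lies in no hypersurface smooth at `0` — the parent entry's ∀-statement for the manuscript's OWN `Σ_max` of the
TYPED `Inv` on this specimen, dimension four, odd characteristic. Still NOT covered: perfect but not algebraically closed `K` at non-rational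
closed points; imperfect `K`; later blow-ups. [claim: Hironaka2017, status: under-review]
[cite: Hironaka2017, p.30 l.4–8 / Eq. (43) · Eq. (34) p.24 l.29–31 · Def. 4.9 p.20 l.31–35 (unrefereed manuscript under adjudication — kernel computation of OUR typed slot at the cell's companion specimen, nothing of the manuscript asserted); AtiyahMacdonald1969, Ch. 7 Cor. 7.10 (weak Nullstellensatz)] -/
theorem SigmaMaxContainsFullEdimCurveW3_slot_algClosed (K : Type) [Field K] [IsAlgClosed K] [CharP K 3] :
    -- (1) the closed singular points are the points of `T(K)`
    (∀ x : Zs (MvPolynomial (Fin 4) K), x ∈ singClosed K ↔ ∃ v ∈ TcSet3 K, x = AffineTransl.pt K v) ∧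
    -- (2) the slot of record on them
    (∀ x ∈ singClosed K, ∀ c : S16Proof.EdgeChoice.{0} 3 4, S16Proof.invOfChoiceBot c (EW3 K) x = SigmaMaxInv3.inv433) ∧
    -- (3) `Invmax` attained, `= (4,3,3)`
    (∀ c : S16Proof.EdgeChoice.{0} 3 4, IsInvmax (singClosed K) (S16Proof.invOfChoiceBot c (EW3 K)) SigmaMaxInv3.inv433) ∧
    -- (4) `Σ_max` of the slot = all closed singular points, containing `pt P₀`
    (∀ c : S16Proof.EdgeChoice.{0} 3 4, invmaxStratum (singClosed K) (S16Proof.invOfChoiceBot c (EW3 K)) = singClosed K) ∧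
    AffineTransl.pt K (fun _ : Fin 4 => (1 : K)) ∈ singClosed K := by
  have hT : ∀ v : Fin 4 → K, v ∈ TcSet3 K ↔ (v = ![0, 0, v 2, 0] ∨ v = ![0, 0, 0, v 3] ∨ ∃ s : K, v = γpt K s) := fun v => Iff.rfl
  refine ⟨fun x => ?_, fun x hx c => invOfChoiceBot_eq_of_mem_singClosed K hx c, isInvmax_singClosed K,
    invmaxStratum_singClosed_eq K, pt_P0_mem_singClosed K⟩
  rw [mem_singClosed_iff]
  constructor
  · rintro ⟨v, rfl, hv⟩
    exact ⟨v, (hT v).mpr hv, rfl⟩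
  · rintro ⟨v, hv, rfl⟩
    exact ⟨v, rfl, (hT v).mp hv⟩

end Literature.Barriers.ResolutionOfSingularities

end
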